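import Summits.ResolutionOfSingularities.ResolutionOfSingularities.Theorems.EquisingularLiftEquisingularLiftNatHostedSubchainPointResolutionE
import Summits.ResolutionOfSingularities.ResolutionOfSingularities.Theorems.EquisingularLiftEquisingularLiftNatResidueHypDefsE2
import Summits.ResolutionOfSingularities.ResolutionOfSingularities.Theorems.EquisingularLiftEquisingularLiftNatHostedRoundSeam
import Summits.ResolutionOfSingularities.ResolutionOfSingularities.Theorems.EquisingularLiftEquisingularLiftNatHostedPointStepSeam
import Summits.ResolutionOfSingularities.ResolutionOfSingularities.Theorems.EquisingularLiftEquisingularLiftNatHostedEngineInit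
import Summits.ResolutionOfSingularities.ResolutionOfSingularities.Theorems.EquisingularLiftEquisingularLiftNatNoseHostedHSUB
import Summits.ResolutionOfSingularities.ResolutionOfSingularities.Theorems.EquisingularLiftEquisingularLiftNatResidueHypDefs
import Summits.ResolutionOfSingularities.ResolutionOfSingularities.Theorems.EquisingularLiftEquisingularLiftNatHSUBeOfSuppliers
import Summits.ResolutionOfSingularities.ResolutionOfSingularities.Theorems.EquisingularLiftEquisingularLiftNatResidueHypDefsE3
import Summits.ResolutionOfSingularities.ResolutionOfSingularities.Theorems.EquisingularLiftEquisingularLiftNatNoseTrace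
import Summits.ResolutionOfSingularities.ResolutionOfSingularities.Theorems.EquisingularLiftEquisingularLiftNatNoseRoundStep
import Summits.ResolutionOfSingularities.ResolutionOfSingularities.Theorems.EquisingularLiftEquisingularLiftNatEquinodalJInitOfNearNode
import Summits.ResolutionOfSingularities.ResolutionOfSingularities.Theorems.EquisingularLiftEquisingularLiftNatEquinodalCoreNoseRegularNode
import HarnessLib

/-!
# [OURS · L1 W4.5(b) · EL♮(3) · WIDTH TABLE D6 «EQUINODAL PLANAR NOSE», row (D6-6)] THE RUNG (R-ν4) `stub_elnat_hostedNestEquinodalNoseBTriplePrimeResolutionThree`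
# `(T-k) → p.Prime → … → NoseHypHostedNestEquinodalBTriplePrime₂ k 3 H ι → ELNatConclusionO k 3 H ι`

res-L1-w45b-lead-2 g8 (text owner; desk R52 (D6-6): RUNGᵉ + 41st texts), over res-L1-w45b-nose-w1 g3's K5ᵉ engine ✓ `target_elnat_of_hostedSubchainResolutionₑ`
(`…NatHostedSubchainPointResolutionE`, = res-L1-w45b-stub-2's K5ʰ v2.2 ✓ p661666 + the HSUBᵉ slot + DefsE2's door clause) and nose-w1's rung shape test
`EngineE-K5e-rungtest2.lean` e80fbd7e46fee73a (crit-3 kernel PASS).  OURS; NOT a statement of any manuscript ([Hironaka2017] is a candidate under adjudication,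
nothing of it is asserted); AI-written, weaker than expert review.  No `sorry`; standard axioms; DEF-FREE; the residue (T-k) `EmbeddedCurveLiftFact` is a
HYPOTHESIS (registered stub of the skeleton of record), so the rung is CONDITIONAL on it exactly as (R-ν1)–(R-ν3) are.  `--supports stmt-ResolutionOfSingularities-20148
--as helper`.  EL♮(3) is NOT proved here: the rung moves the surfaces of the ν4 door «EQUINODAL PLANAR NOSE» (`NoseHypHostedNestEquinodalBTriplePrime₂`,
✓ `…NatResidueHypDefsE2`, res-L1-w45b-nose-w1) out of the non-isolated residue; the 41st registration's residue stub is `¬ NoseHypHostedNestEquinodalBTriplePrime₂`.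

PROOF = ONE application of the K5ᵉ engine at `n := 3`, `ReachH := ReachHostedNoseBTriplePrime`, with the five suppliers BY NAME: HINIT = ✓ `hinit_empty` /
✓ `hinit_hyperplane` (res-L1-w45b-stub-2, by cases on `E₀`), HPT = ✓ `TCPlus.hpt_seam k 3` (res-L1-w45b-stub-4), HROUND₂ = ✓ `TCPlus.hround_seam k hF` (stub-2),
HSUBʰ = ✓ `hsubh_reachHostedNoseBTriplePrime_of_embeddedCurveLiftFact hF k` (res-L1-w45b-nose-w2), HSUBᵉ = ✓ `Equinodal.hsube_of_suppliers` (res-L1-w45b-nose-w1, p676659) at `RD := Equinodal.RPlus` (DefsE3 ✓ p678137) over JINIT ✓ `Equinodal.jinit_rPlus₀_of_nearNode` (nose-w1, p690555: N-0 over the cores S4 ✓ p686680 / S7 ✓ p688665 (res-type-027) / S8 ✓ p688841 (res-L1-w45b-stub-4)) fed with W5b ✓ `Equinodal.nose_regular_near_node` (res-L1-w45b-stub-2 g18), HNODE ✓ `Equinodal.hnode_rPlus` (stub-2, p685353), HRDZ ✓ `Equinodal.hrdz_rPlus` (res-type-027, p679896), HEND ✓ `Equinodal.hend_rPlus` (DefsE3);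 `hres` = the blob unpacked; `hE₀'` = the blob's host disjunction minus its `¬ range ι ⊆ V₊ℓ` conjunct (desk WORD g25-17 shape (B)).
[folklore; pure composition]
-/

set_option linter.dupNamespace false -- mandated namespace `Summit.<Summit>.<Problem>` of this single-conjunct summit

noncomputable section

open CategoryTheory CategoryTheory.Limits AlgebraicGeometry TopologicalSpace Topology
open Literature.AlgebraicGeometry.Resolution
open AlgebraicGeometry.Scheme.IdealSheafData
open Summit.ResolutionOfSingularities.ResolutionOfSingularities.Theses.EquisingularLift.Split
open Summit.ResolutionOfSingularities.ResolutionOfSingularities.Cruxes.EquisingularLift.StrataSplit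

namespace Summit.ResolutionOfSingularities.ResolutionOfSingularities.Cruxes.EquisingularLiftNat.Sections

/-- **THE RUNG (R-ν4): surfaces `H ⊂ ℙ³_k` with a hosted-nest / EQUINODAL-PLANAR-NOSE resolution downstairs (door ν4 v2) satisfy EL♮(3)'s conclusion, given (T-k).**
The type is the 41st texts' call shape VERBATIM ((R-ν1)/(R-ν2)/(R-ν3) binder convention). [OURS · L1 W4.5b · rung of the 41st cut; NOT a statement of the manuscript; EL♮(3) NOT proved] -/
theorem stub_elnat_hostedNestEquinodalNoseBTriplePrimeResolutionThree (p : ℕ) : EmbeddedCurveLiftFact → p.Prime →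
    ∀ (k : Type) [Field k] [CharP k p] [IsAlgClosed k] (H : AlgebraicGeometry.Scheme.{0})
    (ι : H ⟶ (Literature.AlgebraicGeometry.Motives.projectiveSpace 3 k).left),
    AlgebraicGeometry.IsClosedImmersion ι → AlgebraicGeometry.IsIntegral H →
    (∀ y : (Literature.AlgebraicGeometry.Motives.projectiveSpace 3 k).left,
      ∃ U : (Literature.AlgebraicGeometry.Motives.projectiveSpace 3 k).left.affineOpens,
        y ∈ (U : (Literature.AlgebraicGeometry.Motives.projectiveSpace 3 k).left.Opens) ∧ (ι.ker.ideal U).IsPrincipal) →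
    NoseHypHostedNestEquinodalBTriplePrime₂ k 3 H ι → ELNatConclusionO k 3 H ι := by
  intro hF hp k _ _ _ H ι hι hH hloc hν
  haveI := hι; haveI := hH
  letI := MvPolynomial.gradedAlgebra (σ := Fin (3 + 1)) (R := k)
  obtain ⟨E₀, hE₀, hres⟩ := hν
  -- F4's outer hypothesis on the initial host (the blob's disjunction minus its `¬ range ι ⊆ V₊ ℓ` conjunct)
  have hE₀' : E₀ = ∅ ∨ ∃ ℓ₀ : MvPolynomial (Fin (3 + 1)) k, ℓ₀.IsHomogeneous 1 ∧ ℓ₀ ≠ 0 ∧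
      E₀ = {y : (Literature.AlgebraicGeometry.Motives.projectiveSpace 3 k).left | ℓ₀ ∈ (y : ProjectiveSpectrum (MvPolynomial.homogeneousSubmodule (Fin (3 + 1)) k)).asHomogeneousIdeal} :=
    hE₀.imp id (fun ⟨ℓ₀, h1, h0, _, h⟩ => ⟨ℓ₀, h1, h0, h⟩)
  rcases hE₀ with rfl | ⟨ℓ, hℓ1, hℓ0, hHℓ, rfl⟩
  · exact target_elnat_of_hostedSubchainResolutionₑ p hp k 3 H ι hι hH hloc ∅ ReachHostedNoseBTriplePrime (hinit_empty k 3 H ι)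
      (TCPlus.hpt_seam k 3) (TCPlus.hround_seam k hF) (hsubh_reachHostedNoseBTriplePrime_of_embeddedCurveLiftFact hF k)
      (fun O _ _ _ _ _ θ hθ φ hφ' hφ Ch hChStep hChSplit hYsp hYirr hYcl hPint hPnoeth hPreg hqprop hqsm hCh₀ h𝓔₀ ℓ' F₉ β T₉ E₉ hE₀ hR =>
        Equinodal.hsube_of_suppliers hF k O θ hθ _ _ _ Ch hChStep hChSplit hYsp hYirr hYcl hPint hPnoeth hPreg hqprop hqsm ℓ' (Set.range ι)
          (Equinodal.RPlus k O θ _ _ _ Ch)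
          (Equinodal.jinit_rPlus₀_of_nearNode k H ι hι hH _ hE₀' (Equinodal.nose_regular_near_node k) O θ hθ φ hφ' hφ Ch hChStep hChSplit hYsp hYirr hYcl
            hPint hPnoeth hPreg hqprop hqsm hCh₀ h𝓔₀ ℓ' hE₀)
          (Equinodal.hnode_rPlus k O θ hθ _ _ _ Ch hChStep hChSplit hYsp hYirr hYcl hPint hPnoeth hPreg hqprop hqsm)
          (Equinodal.hrdz_rPlus k O θ hθ _ _ _ Ch hChStep hChSplit hYsp hYirr hYcl hPint hPnoeth hPreg hqprop hqsm (hF k O θ hθ _ _))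
          (Equinodal.hend_rPlus k O θ _ _ _ Ch) F₉ β T₉ E₉ hR) hres
  · exact target_elnat_of_hostedSubchainResolutionₑ p hp k 3 H ι hι hH hloc _ ReachHostedNoseBTriplePrime
      (hinit_hyperplane k 2 H ι ℓ hℓ1 hℓ0 hHℓ) (TCPlus.hpt_seam k 3) (TCPlus.hround_seam k hF)
      (hsubh_reachHostedNoseBTriplePrime_of_embeddedCurveLiftFact hF k)
      (fun O _ _ _ _ _ θ hθ φ hφ' hφ Ch hChStep hChSplit hYsp hYirr hYcl hPint hPnoeth hPreg hqprop hqsm hCh₀ h𝓔₀ ℓ' F₉ β T₉ E₉ hE₀ hR =>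
        Equinodal.hsube_of_suppliers hF k O θ hθ _ _ _ Ch hChStep hChSplit hYsp hYirr hYcl hPint hPnoeth hPreg hqprop hqsm ℓ' (Set.range ι)
          (Equinodal.RPlus k O θ _ _ _ Ch)
          (Equinodal.jinit_rPlus₀_of_nearNode k H ι hι hH _ hE₀' (Equinodal.nose_regular_near_node k) O θ hθ φ hφ' hφ Ch hChStep hChSplit hYsp hYirr hYcl
            hPint hPnoeth hPreg hqprop hqsm hCh₀ h𝓔₀ ℓ' hE₀)
          (Equinodal.hnode_rPlus k O θ hθ _ _ _ Ch hChStep hChSplit hYsp hYirr hYcl hPint hPnoeth hPreg hqprop hqsm)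
          (Equinodal.hrdz_rPlus k O θ hθ _ _ _ Ch hChStep hChSplit hYsp hYirr hYcl hPint hPnoeth hPreg hqprop hqsm (hF k O θ hθ _ _))
          (Equinodal.hend_rPlus k O θ _ _ _ Ch) F₉ β T₉ E₉ hR) hres

end Summit.ResolutionOfSingularities.ResolutionOfSingularities.Cruxes.EquisingularLiftNat.Sections

end
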